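import Summits.AnomalousDissipation.AnomalousDissipation.Theorems.MomentParityQuarticGateCubicComplexify
import Summits.AnomalousDissipation.AnomalousDissipation.Theorems.MomentParityQuarticGateFourierDictionaryPart3
import Mathlib.Algebra.MvPolynomial.PDeriv
import Mathlib.Algebra.MvPolynomial.Monad

/-!
# Complexified reduction for the axial Casimir stubs (line `axis-sectors` of crux `MomentParity.QuarticGate`), II

The COMPLEXIFIED Casimir expression of a polynomial observable `P` (real coefficients) with test
families `vⱼ` (for band tests, `vⱼ = tcoef gⱼ`):
`G(c) = Σᵢ (∂ᵢPℂ)((ℓ_{vⱼ}(c))ⱼ) · B_{vᵢ}(c, c)`, `Pℂ = map (algebraMap ℝ ℂ) P`, with the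
conjugation-free coordinate functionals `ℓ` and bracket forms `B` of part I, written out as explicit
sums. Results:
* `mvPolynomial_eq_zero_of_forall_eval_ofReal_eq_zero` — a complex polynomial vanishing at all REAL
  points vanishes (split into real and imaginary coefficient polynomials; part 3);
* `eval_ofReal_map_algebraMap`, `eval_bind₁_eq` — bookkeeping (`Pℂ` at real points, substitution);
* `casimirC_two_families` — along a complex pencil `z₀ a + z₁ b` the expression `G` is the evaluation
  of an explicit polynomial in `(z₀, z₁)` (linearity of `ℓ`, bilinearity of `B`);
* `casimirC_eq_zero_of_forall_admissible` — THE MAIN LEMMA: if `G(c) = 0` for every ADMISSIBLE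
  (conjugate-symmetric, transversal, supported in `S*`) family then `G(c) = 0` for EVERY complex family
  transversal on and supported in `S*` (real form `c = a + i b`, part I, and the pencil through `a, b`);
* `casimirC_eq_ofReal`, `observableC_eq_ofReal` — on admissible families `G` and the complexified
  observable are the real dictionary expressions (`casimir_iff_coef`, part 1 of the dictionary);
* `casimirC_eq_zero_of_casimir` — CONSUMER FORM: the Casimir clause of the stubs implies `G ≡ 0` on
  all complex transversal families supported in `S* = (freqBall N).erase 0`.
-/

namespace Summit.AnomalousDissipation.AnomalousDissipation.Theorems.MomentParityQuarticGate

open MeasureTheory Filter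
open scoped InnerProductSpace RealInnerProductSpace ComplexConjugate ENNReal
open Literature.Analysis.FunctionSpaces Literature.Analysis.FluidPDE
open Summit.AnomalousDissipation.AnomalousDissipation.Theses.MomentParity
open Summit.AnomalousDissipation.AnomalousDissipation.Theorems.QuarticGate.Negative

-- `Summit.<Summit>.<Problem>` is the tree's mandated summit-side namespace (CONVENTIONS §2); for this
-- single-conjunct summit the two coincide, so the duplicate is deliberate.
set_option linter.dupNamespace false

noncomputable section

/-! ## Complex polynomials vanishing on the real form -/

section RealPoints

/-- **A complex polynomial that vanishes at every real point is zero** (its real- and imaginary-part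
polynomials vanish on `ℝ^σ`, hence are zero, `ℝ` being infinite). [folklore] -/
theorem mvPolynomial_eq_zero_of_forall_eval_ofReal_eq_zero {σ : Type*} (Q : MvPolynomial σ ℂ)
    (h : ∀ x : σ → ℝ, MvPolynomial.eval (fun i => (x i : ℂ)) Q = 0) : Q = 0 := by
  classical
  -- real and imaginary coefficient polynomials
  set Qr : MvPolynomial σ ℝ := ∑ e ∈ Q.support, MvPolynomial.monomial e (Q.coeff e).re with hQr
  set Qi : MvPolynomial σ ℝ := ∑ e ∈ Q.support, MvPolynomial.monomial e (Q.coeff e).im with hQi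
  have hcr : ∀ e, Qr.coeff e = (Q.coeff e).re := fun e => by
    rw [hQr, MvPolynomial.coeff_sum]
    simp only [MvPolynomial.coeff_monomial]
    rw [Finset.sum_ite_eq']
    split_ifs with he
    · rfl
    · rw [MvPolynomial.notMem_support_iff.1 he, Complex.zero_re]
  have hci : ∀ e, Qi.coeff e = (Q.coeff e).im := fun e => by
    rw [hQi, MvPolynomial.coeff_sum]
    simp only [MvPolynomial.coeff_monomial]
    rw [Finset.sum_ite_eq']
    split_ifs with he
    · rfl
    · rw [MvPolynomial.notMem_support_iff.1 he, Complex.zero_im]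
  -- `Q = Qr + i Qi`
  have hdec : Q = MvPolynomial.map Complex.ofRealHom Qr + MvPolynomial.C Complex.I * MvPolynomial.map Complex.ofRealHom Qi := by
    refine MvPolynomial.ext _ _ fun e => ?_
    rw [MvPolynomial.coeff_add, MvPolynomial.coeff_C_mul, MvPolynomial.coeff_map, MvPolynomial.coeff_map,
      hcr, hci, Complex.ofRealHom_eq_coe, Complex.ofRealHom_eq_coe, mul_comm, Complex.re_add_im]
  -- evaluation at real points
  have heval : ∀ (R : MvPolynomial σ ℝ) (x : σ → ℝ),
      MvPolynomial.eval (fun i => (x i : ℂ)) (MvPolynomial.map Complex.ofRealHom R) = (MvPolynomial.eval x R : ℂ) := by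
    intro R x
    rw [MvPolynomial.eval_map, ← Complex.ofRealHom_eq_coe, ← MvPolynomial.eval₂_id,
      MvPolynomial.eval₂_comp_left Complex.ofRealHom (RingHom.id ℝ) x R]
    rfl
  have hr : ∀ x : σ → ℝ, MvPolynomial.eval x Qr = 0 ∧ MvPolynomial.eval x Qi = 0 := fun x => by
    have hx := h x
    rw [hdec, map_add, map_mul, MvPolynomial.eval_C, heval, heval] at hx
    have h2 := congrArg Complex.re hx
    have h3 := congrArg Complex.im hx
    simp only [Complex.add_re, Complex.ofReal_re, Complex.mul_re, Complex.I_re, zero_mul, Complex.I_im,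
      Complex.ofReal_im, mul_zero, sub_zero, add_zero, Complex.zero_re, Complex.add_im, Complex.mul_im,
      one_mul, zero_add, Complex.zero_im] at h2 h3
    exact ⟨h2, h3⟩
  have hQr0 : Qr = 0 := eq_zero_of_forall_eval_eq_zero Qr fun x => (hr x).1
  have hQi0 : Qi = 0 := eq_zero_of_forall_eval_eq_zero Qi fun x => (hr x).2
  rw [hdec, hQr0, hQi0]
  simp

/-- **The complexified polynomial at real points**: `(map (algebraMap ℝ ℂ) P)((↑xⱼ)ⱼ) = ↑(P(x))`. [folklore] -/
theorem eval_ofReal_map_algebraMap {σ : Type*} (P : MvPolynomial σ ℝ) (x : σ → ℝ) :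
    MvPolynomial.eval (fun j => (x j : ℂ)) (MvPolynomial.map (algebraMap ℝ ℂ) P) = (MvPolynomial.eval x P : ℂ) := by
  have halg : algebraMap ℝ ℂ = Complex.ofRealHom := RingHom.ext fun _ => rfl
  rw [halg, MvPolynomial.eval_map, ← Complex.ofRealHom_eq_coe, ← MvPolynomial.eval₂_id,
    MvPolynomial.eval₂_comp_left Complex.ofRealHom (RingHom.id ℝ) x P]
  rfl

/-- **Substitution**: `(bind₁ L φ)(z) = φ((Lⱼ(z))ⱼ)`. [folklore] -/
theorem eval_bind₁_eq {σ τ : Type*} (z : τ → ℂ) (L : σ → MvPolynomial τ ℂ) (φ : MvPolynomial σ ℂ) :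
    MvPolynomial.eval z (MvPolynomial.bind₁ L φ) = MvPolynomial.eval (fun j => MvPolynomial.eval z (L j)) φ := by
  show MvPolynomial.eval₂Hom (RingHom.id ℂ) z (MvPolynomial.bind₁ L φ) =
    MvPolynomial.eval₂Hom (RingHom.id ℂ) _ φ
  rw [MvPolynomial.eval₂Hom_bind₁]
  rfl

end RealPoints

/-! ## The complexified Casimir expression along a pencil of two families -/

section Pencil

variable {N m : ℕ}

/-- The coordinate functional along the pencil: `ℓ_v(z₀ a + z₁ b) = z₀ ℓ_v(a) + z₁ ℓ_v(b)`. [folklore] -/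
theorem ell_pencil (S : Finset (Fin 3 → ℤ)) (a b v : (Fin 3 → ℤ) → EuclideanSpace ℂ (Fin 3)) (z : Fin 2 → ℂ) :
    ∑ k ∈ S, ∑ i', (z 0 • a k + z 1 • b k) i' * v (-k) i' =
      z 0 * ∑ k ∈ S, ∑ i', a k i' * v (-k) i' + z 1 * ∑ k ∈ S, ∑ i', b k i' * v (-k) i' := by
  rw [Finset.mul_sum, Finset.mul_sum, ← Finset.sum_add_distrib]
  refine Finset.sum_congr rfl fun k _ => ?_
  rw [Finset.mul_sum, Finset.mul_sum, ← Finset.sum_add_distrib]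
  refine Finset.sum_congr rfl fun i _ => ?_
  simp only [PiLp.add_apply, PiLp.smul_apply, smul_eq_mul]
  ring

/-- The bracket form along the pencil:
`B_v(c_z, c_z) = z₀² B(a,a) + z₀z₁ (B(a,b) + B(b,a)) + z₁² B(b,b)`, `c_z = z₀ a + z₁ b`. [folklore] -/
theorem bracketForm_pencil (S : Finset (Fin 3 → ℤ)) (a b v : (Fin 3 → ℤ) → EuclideanSpace ℂ (Fin 3))
    (z : Fin 2 → ℂ) :
    ∑ k ∈ S, ∑ i', (Torus.convectionCoeff S (fun k => z 0 • a k + z 1 • b k) v k) i' * (z 0 • a (-k) + z 1 • b (-k)) i' =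
      z 0 ^ 2 * ∑ k ∈ S, ∑ i', (Torus.convectionCoeff S a v k) i' * a (-k) i' +
      z 0 * z 1 * (∑ k ∈ S, ∑ i', (Torus.convectionCoeff S a v k) i' * b (-k) i' +
        ∑ k ∈ S, ∑ i', (Torus.convectionCoeff S b v k) i' * a (-k) i') +
      z 1 ^ 2 * ∑ k ∈ S, ∑ i', (Torus.convectionCoeff S b v k) i' * b (-k) i' := by
  have hfun : (fun k => z 0 • a k + z 1 • b k) = z 0 • a + z 1 • b := rfl
  rw [hfun]
  have hterm : ∀ k i', (Torus.convectionCoeff S (z 0 • a + z 1 • b) v k) i' * (z 0 • a (-k) + z 1 • b (-k)) i' =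
      z 0 ^ 2 * ((Torus.convectionCoeff S a v k) i' * a (-k) i') +
      z 0 * z 1 * ((Torus.convectionCoeff S a v k) i' * b (-k) i' + (Torus.convectionCoeff S b v k) i' * a (-k) i') +
      z 1 ^ 2 * ((Torus.convectionCoeff S b v k) i' * b (-k) i') := fun k i' => by
    rw [Torus.convectionCoeff_add_left, Torus.convectionCoeff_smul_left, Torus.convectionCoeff_smul_left]
    simp only [PiLp.add_apply, PiLp.smul_apply, smul_eq_mul]
    ring
  simp_rw [hterm]
  simp only [Finset.sum_add_distrib, ← Finset.mul_sum]

/-- **The complexified Casimir expression along a pencil is an explicit polynomial in `(z₀, z₁)`.**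
For families `a, b`, tests `v` and a real polynomial `P`, there is `Q : MvPolynomial (Fin 2) ℂ` with
`G(z₀ a + z₁ b) = Q(z)` for all `z : Fin 2 → ℂ`, where
`G(c) = Σᵢ (∂ᵢPℂ)((ℓ_{vⱼ}(c))ⱼ) · B_{vᵢ}(c, c)`. [folklore] -/
theorem casimirC_two_families (N : ℕ) {m : ℕ} (a b : (Fin 3 → ℤ) → EuclideanSpace ℂ (Fin 3))
    (v : Fin m → (Fin 3 → ℤ) → EuclideanSpace ℂ (Fin 3)) (P : MvPolynomial (Fin m) ℝ) :
    ∃ Q : MvPolynomial (Fin 2) ℂ, ∀ z : Fin 2 → ℂ,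
      ∑ i, MvPolynomial.eval (fun j => ∑ k ∈ (Torus.freqBall N).erase 0, ∑ i', (z 0 • a k + z 1 • b k) i' * v j (-k) i')
          (MvPolynomial.pderiv i (MvPolynomial.map (algebraMap ℝ ℂ) P)) *
        ∑ k ∈ Torus.freqBall N, ∑ i',
          (Torus.convectionCoeff (Torus.freqBall N) (fun k => z 0 • a k + z 1 • b k) (v i) k) i' *
            (z 0 • a (-k) + z 1 • b (-k)) i' = MvPolynomial.eval z Q := by
  -- the linear forms `ℓⱼ` and the quadratic forms `Bᵢ` as polynomials in `z`
  set L : Fin m → MvPolynomial (Fin 2) ℂ := fun j =>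
    MvPolynomial.C (∑ k ∈ (Torus.freqBall N).erase 0, ∑ i', a k i' * v j (-k) i') * MvPolynomial.X 0 +
    MvPolynomial.C (∑ k ∈ (Torus.freqBall N).erase 0, ∑ i', b k i' * v j (-k) i') * MvPolynomial.X 1 with hL
  set Bq : Fin m → MvPolynomial (Fin 2) ℂ := fun i =>
    MvPolynomial.C (∑ k ∈ Torus.freqBall N, ∑ i', (Torus.convectionCoeff (Torus.freqBall N) a (v i) k) i' * a (-k) i') *
        MvPolynomial.X 0 ^ 2 +
      MvPolynomial.C (∑ k ∈ Torus.freqBall N, ∑ i', (Torus.convectionCoeff (Torus.freqBall N) a (v i) k) i' * b (-k) i' +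
          ∑ k ∈ Torus.freqBall N, ∑ i', (Torus.convectionCoeff (Torus.freqBall N) b (v i) k) i' * a (-k) i') *
        MvPolynomial.X 0 * MvPolynomial.X 1 +
      MvPolynomial.C (∑ k ∈ Torus.freqBall N, ∑ i', (Torus.convectionCoeff (Torus.freqBall N) b (v i) k) i' * b (-k) i') *
        MvPolynomial.X 1 ^ 2 with hBq
  refine ⟨∑ i, MvPolynomial.bind₁ L (MvPolynomial.pderiv i (MvPolynomial.map (algebraMap ℝ ℂ) P)) * Bq i, fun z => ?_⟩
  have hℓ : (fun j => ∑ k ∈ (Torus.freqBall N).erase 0, ∑ i', (z 0 • a k + z 1 • b k) i' * v j (-k) i') =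
      fun j => MvPolynomial.eval z (L j) := by
    funext j
    rw [ell_pencil, hL]
    simp only [map_add, map_mul, MvPolynomial.eval_C, MvPolynomial.eval_X]
    ring
  have hB : ∀ i, ∑ k ∈ Torus.freqBall N, ∑ i',
      (Torus.convectionCoeff (Torus.freqBall N) (fun k => z 0 • a k + z 1 • b k) (v i) k) i' *
        (z 0 • a (-k) + z 1 • b (-k)) i' = MvPolynomial.eval z (Bq i) := fun i => by
    rw [bracketForm_pencil, hBq]
    simp only [map_add, map_mul, map_pow, MvPolynomial.eval_C, MvPolynomial.eval_X]
    ring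
  rw [hℓ, map_sum]
  refine Finset.sum_congr rfl fun i _ => ?_
  rw [map_mul, hB i, eval_bind₁_eq]

end Pencil

/-! ## The main lemma: vanishing on the real form implies vanishing on all complex families -/

section Main

/-- **MAIN LEMMA — the complexified Casimir expression vanishes on all of `C_N` once it vanishes on the
admissible families.** Let `vⱼ` be test families and `P` a real polynomial. If
`G(c) = Σᵢ (∂ᵢPℂ)((ℓ_{vⱼ}(c))ⱼ) · B_{vᵢ}(c, c) = 0` for every conjugate-symmetric `c` transversal on and
supported in `S* = (freqBall N).erase 0`, then `G(c) = 0` for EVERY complex family `c` transversal on and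
supported in `S*`: write `c = a + i b` with admissible `a, b` (part I); along the pencil `z₀ a + z₁ b`,
`G` is a polynomial in `z ∈ ℂ²` vanishing on `ℝ²`, hence zero, in particular at `z = (1, i)`. [folklore] -/
theorem casimirC_eq_zero_of_forall_admissible (N : ℕ) {m : ℕ}
    (v : Fin m → (Fin 3 → ℤ) → EuclideanSpace ℂ (Fin 3)) (P : MvPolynomial (Fin m) ℝ)
    (hG : ∀ c : (Fin 3 → ℤ) → EuclideanSpace ℂ (Fin 3), Torus.IsConjSymm c →
      Torus.IsTransversal ((Torus.freqBall N).erase 0) c →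
      (∀ k ∉ (Torus.freqBall N).erase (0 : Fin 3 → ℤ), c k = 0) →
      ∑ i, MvPolynomial.eval (fun j => ∑ k ∈ (Torus.freqBall N).erase 0, ∑ i', c k i' * v j (-k) i')
          (MvPolynomial.pderiv i (MvPolynomial.map (algebraMap ℝ ℂ) P)) *
        ∑ k ∈ Torus.freqBall N, ∑ i', (Torus.convectionCoeff (Torus.freqBall N) c (v i) k) i' * c (-k) i' = 0)
    (c : (Fin 3 → ℤ) → EuclideanSpace ℂ (Fin 3)) (hT : Torus.IsTransversal ((Torus.freqBall N).erase 0) c)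
    (hsupp : ∀ k ∉ (Torus.freqBall N).erase (0 : Fin 3 → ℤ), c k = 0) :
    ∑ i, MvPolynomial.eval (fun j => ∑ k ∈ (Torus.freqBall N).erase 0, ∑ i', c k i' * v j (-k) i')
        (MvPolynomial.pderiv i (MvPolynomial.map (algebraMap ℝ ℂ) P)) *
      ∑ k ∈ Torus.freqBall N, ∑ i', (Torus.convectionCoeff (Torus.freqBall N) c (v i) k) i' * c (-k) i' = 0 := by
  obtain ⟨a, b, ha, hb, hTa, hTb, hsa, hsb, hc⟩ :=
    exists_admissible_decomposition neg_mem_freqBall_erase_zero c hT hsupp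
  obtain ⟨Q, hQ⟩ := casimirC_two_families N a b v P
  -- `Q` vanishes on `ℝ²`
  have hQ0 : Q = 0 := by
    refine mvPolynomial_eq_zero_of_forall_eval_ofReal_eq_zero Q fun x => ?_
    rw [← hQ fun i => (x i : ℂ)]
    obtain ⟨h1, h2, h3⟩ := admissible_real_combination ha hb hTa hTb hsa hsb (x 0) (x 1)
    exact hG _ h1 h2 h3
  -- evaluate at `z = (1, i)`
  have key := hQ ![1, Complex.I]
  rw [hQ0, map_zero] at key
  simp only [Matrix.cons_val_zero, Matrix.cons_val_one, one_smul] at key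
  have hc' : c = fun k => a k + Complex.I • b k := funext hc
  simp only [hc']
  exact key

end Main

/-! ## The link with the real dictionary expressions -/

section Link

variable {N m : ℕ}

/-- **On admissible families the complexified observable is the real one**:
`Pℂ((ℓ_{ĝⱼ}(c))ⱼ) = ↑(P((Σ_{k∈S*} Re⟪c k, ĝⱼ k⟫)ⱼ))` for conjugate-symmetric `c` and band tests `g`. [folklore] -/
theorem observableC_eq_ofReal {c : (Fin 3 → ℤ) → EuclideanSpace ℂ (Fin 3)} (hc : Torus.IsConjSymm c)
    (g : Fin m → UnitAddTorus (Fin 3) → EuclideanSpace ℝ (Fin 3)) (hg : ∀ i, IsBandTest N (g i))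
    (P : MvPolynomial (Fin m) ℝ) :
    MvPolynomial.eval (fun j => ∑ k ∈ (Torus.freqBall N).erase 0, ∑ i', c k i' * tcoef (g j) (-k) i')
        (MvPolynomial.map (algebraMap ℝ ℂ) P) =
      ((MvPolynomial.eval (fun j => ∑ k ∈ (Torus.freqBall N).erase 0, (inner ℂ (c k) (tcoef (g j) k)).re) P : ℝ) : ℂ) := by
  rw [show (fun j => ∑ k ∈ (Torus.freqBall N).erase 0, ∑ i', c k i' * tcoef (g j) (-k) i') =
      fun j => (((∑ k ∈ (Torus.freqBall N).erase 0, (inner ℂ (c k) (tcoef (g j) k)).re : ℝ)) : ℂ) from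
    funext fun j => ell_eq_ofReal hc (isConjSymm_tcoef (hg j).1.integrable)]
  exact eval_ofReal_map_algebraMap P _

/-- **On admissible families the complexified Casimir expression is the real one** (the right-hand side
of `casimir_iff_coef` of the dictionary, cast to `ℂ`). [folklore] -/
theorem casimirC_eq_ofReal {c : (Fin 3 → ℤ) → EuclideanSpace ℂ (Fin 3)} (hc : Torus.IsConjSymm c)
    (g : Fin m → UnitAddTorus (Fin 3) → EuclideanSpace ℝ (Fin 3)) (hg : ∀ i, IsBandTest N (g i))
    (P : MvPolynomial (Fin m) ℝ) :
    ∑ i, MvPolynomial.eval (fun j => ∑ k ∈ (Torus.freqBall N).erase 0, ∑ i', c k i' * tcoef (g j) (-k) i')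
        (MvPolynomial.pderiv i (MvPolynomial.map (algebraMap ℝ ℂ) P)) *
      ∑ k ∈ Torus.freqBall N, ∑ i', (Torus.convectionCoeff (Torus.freqBall N) c (tcoef (g i)) k) i' * c (-k) i' =
      ((∑ i, MvPolynomial.eval (fun j => ∑ k ∈ (Torus.freqBall N).erase 0,
            (inner ℂ (c k) (tcoef (g j) k)).re) (MvPolynomial.pderiv i P) *
          ∑ k ∈ Torus.freqBall N,
            (inner ℂ (Torus.convectionCoeff (Torus.freqBall N) c (tcoef (g i)) k) (c k)).re : ℝ) : ℂ) := by
  push_cast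
  refine Finset.sum_congr rfl fun i _ => ?_
  rw [MvPolynomial.pderiv_map, observableC_eq_ofReal hc g hg,
    bracketForm_eq_ofReal hc (isConjSymm_tcoef (hg i).1.integrable)]
  push_cast
  rfl

/-- **CONSUMER FORM — the Casimir clause, complexified.** If `p = P((·, g))` is a Casimir of level-`N`
Galerkin–Euler (`⟨B(u), ∇p(u)⟩ = 0` for all level-`N` `u`; band tests `g`), then the conjugation-free
complexified Casimir expression `G(c) = Σᵢ (∂ᵢPℂ)((ℓ_{ĝⱼ}(c))ⱼ) · B_{ĝᵢ}(c, c)` vanishes for EVERY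
complex family `c` transversal on and supported in `S* = (freqBall N).erase 0` — in particular on the
single-mode families of part I. [folklore] -/
theorem casimirC_eq_zero_of_casimir (g : Fin m → UnitAddTorus (Fin 3) → EuclideanSpace ℝ (Fin 3))
    (hg : ∀ i, IsBandTest N (g i)) (P : MvPolynomial (Fin m) ℝ)
    (hcas : ∀ u : Torus.energySpace (Fin 3), IsLevel N u →
      Torus.nsGeneratorPairing (d := Fin 3) 0 0 u (polyGrad g P u) = 0)
    (c : (Fin 3 → ℤ) → EuclideanSpace ℂ (Fin 3)) (hT : Torus.IsTransversal ((Torus.freqBall N).erase 0) c)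
    (hsupp : ∀ k ∉ (Torus.freqBall N).erase (0 : Fin 3 → ℤ), c k = 0) :
    ∑ i, MvPolynomial.eval (fun j => ∑ k ∈ (Torus.freqBall N).erase 0, ∑ i', c k i' * tcoef (g j) (-k) i')
        (MvPolynomial.pderiv i (MvPolynomial.map (algebraMap ℝ ℂ) P)) *
      ∑ k ∈ Torus.freqBall N, ∑ i', (Torus.convectionCoeff (Torus.freqBall N) c (tcoef (g i)) k) i' * c (-k) i' = 0 := by
  refine casimirC_eq_zero_of_forall_admissible N (fun j => tcoef (g j)) P (fun c' hc' hT' hsupp' => ?_) c hT hsupp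
  rw [casimirC_eq_ofReal hc' g hg P, (casimir_iff_coef g hg P).1 hcas c' hc' hT' hsupp', Complex.ofReal_zero]

end Link

end

/-! ## Registered sub-goal (summary) -/

/-- **Registered sub-goal `cubicComplexify_casimirC_eq_zero_of_casimir` (summary of this file)**: the
Casimir clause of level-`N` Galerkin–Euler for `p = P((·, g))` with band tests `g` implies that the
conjugation-free complexified Casimir expression
`Σᵢ (∂ᵢPℂ)((Σ_{k∈S*} Σᵢ' c k i' · ĝⱼ(-k) i')ⱼ) · Σ_{k∈S} Σᵢ' (convectionCoeff S c ĝᵢ k) i' · c (-k) i'`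
(`Pℂ = map (algebraMap ℝ ℂ) P`, `S = freqBall N`, `S* = S.erase 0`) vanishes for EVERY complex family `c`
transversal on and supported in `S*` (no reality condition). [folklore] -/
theorem cubicComplexify_casimirC_eq_zero_of_casimir : ∀ (N m : ℕ) (g : Fin m → UnitAddTorus (Fin 3) → EuclideanSpace ℝ (Fin 3)) (P : MvPolynomial (Fin m) ℝ), (∀ i, IsBandTest N (g i)) → (∀ u : Torus.energySpace (Fin 3), IsLevel N u → Torus.nsGeneratorPairing (d := Fin 3) 0 0 u (polyGrad g P u) = 0) → ∀ c : (Fin 3 → ℤ) → EuclideanSpace ℂ (Fin 3), Torus.IsTransversal ((Torus.freqBall N).erase 0) c → (∀ k ∉ (Torus.freqBall N).erase (0 : Fin 3 → ℤ), c k = 0) → ∑ i, MvPolynomial.eval (fun j => ∑ k ∈ (Torus.freqBall N).erase 0, ∑ i', c k i' * UnitAddTorus.mFourierCoeff (EuclideanSpace.complexify ∘ g j) (-k) i') (MvPolynomial.pderiv i (MvPolynomial.map (algebraMap ℝ ℂ) P)) * ∑ k ∈ Torus.freqBall N, ∑ i', (Torus.convectionCoeff (Torus.freqBall N) c (fun k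 => UnitAddTorus.mFourierCoeff (EuclideanSpace.complexify ∘ g i) k) k) i' * c (-k) i' = 0 :=
  fun _ _ g P hg hcas c hT hsupp => casimirC_eq_zero_of_casimir g hg P hcas c hT hsupp

end Summit.AnomalousDissipation.AnomalousDissipation.Theorems.MomentParityQuarticGate
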